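import Summits.CriticalPhenomena.SAWScalingLimit.Cruxes.MassRatio.DisproofExhaustion

/-!
# Disproof companion (cycle 4, §L): THE EXPONENT CUT IS IMMATERIAL for the load-bearing analysis

Companion workfile of `Cruxes/MassRatio/Disproof.lean` (refuter, `cdisprove`, crux `MassRatio` =
stmt-CriticalPhenomena-8550); imports `DisproofExhaustion` (hence the whole toolkit) and lives in the
same namespace. `sorry`-free, axioms `propext, Classical.choice, Quot.sound`. LANDED verbatim (modulo
namespace) as `Theorems/MassRatio/Negative/AnyCutA.lean`, `AnyCutB.lean` (parts 17–18 of the landed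
negative series `Summits.CriticalPhenomena.SAWScalingLimit.Theorems.MassRatio.Negative.*`).

* `endgame_rpow` — an eventual `δ² x^{ℓ_δ} ≤ C δ^{-c} x^{ℓ_δ+N_δ}` with `N_δ ≥ κ/δ`, `κ > 0`, is absurd
  for EVERY real `c` (`x^{N} ≤ e^{-κ log(5/3)/δ}` beats every power; Mathlib
  `tendsto_rpow_mul_exp_neg_mul_atTop_nhds_zero ∘ tendsto_inv_nhdsGT_zero`);
* `violates_of_core`, `Λ₂_violates_at (c C τ)`, `Λ₁_violates_at (c C τ)`, `Λ₃_violates_at (c C σ τ)`;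
* named frame pieces `Flat`, `Frame`, `FrameNoRows`, `Exhausts`, `ALim`, `BLim`, `Conclusion c σ τ`,
  the parametrised crux `MassRatioAt c σ τ` with `massRatio_iff_at : MassRatio ↔ MassRatioAt (3/4) 0 0`;
* **`massRatioAt_false_without_rows (c τ)`, `massRatioAt_false_without_rho_pos (c τ)`,
  `massRatioAt_false_without_bLimit (c τ)`, `massRatioAt_false_without_exhaustion (c σ τ)`** — the four
  load-bearing hypotheses stay load-bearing at every polynomial cut `δ^{-c}` (even `c ≥ 1`) and every
  normalising spin `τ` at `b_δ` (for exhaustion also every bulk spin `σ`): the witnesses starve `b_δ`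
  EXPONENTIALLY in `1/δ`. So a planner's re-cut of the crux (BUDGET.md: `c ∈ (37/48, 1)`) changes
  nothing here, and the dead line's stub 2 without exhaustion (`= MassRatioAtWithoutExhaustion s (5/8) 0`)
  is false at every `s`, not only `s ≤ 1` (cycle 3).
-/

namespace Summit.CriticalPhenomena.SAWScalingLimit.Cruxes.MassRatio.Disproof

open Literature.Probability.LatticeModels Literature.Probability.RandomPlanarGeometry.SAW
open Literature.Probability.RandomPlanarGeometry
open Summit.CriticalPhenomena.SAWScalingLimit.Theses.SAWDefectDecoherence

/-! ## §L (cycle 4). The exponent cut is immaterial for the four load-bearing-hypothesis families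

Every refuted variant of Parts 8, 10, 16 has the form "`δ² Σ_K |F_σ| ≤ C δ^{-3/4} |F_τ(b_δ)|`
eventually". The witnesses starve `b_δ` by a factor `x_c^{≍ 1/δ}` — EXPONENTIALLY in `1/δ` — so the
same families refute the statements at EVERY polynomial cut `δ^{-c}`, `c : ℝ` arbitrary (and every
normalising spin `τ`; for `Λ₃` also every bulk spin `σ`). Consequence for planners: re-cutting the
crux (e.g. to `c ∈ (37/48, 1)` as BUDGET.md suggests, or even to `c ≥ 1`) does not change which
hypotheses are load-bearing; any proof at any cut must use the rows clause, `0 < ρ`, `b_δ → b` and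
exhaustion quantitatively. -/

/-- `|F_{x,τ}(z)| ≤ |F_{x,0}(z)| = Z(z)` for `x ≥ 0` (unimodular winding weights). [folklore] -/
theorem norm_F_le_norm_Z (Λ : Finset HexVertex) (a z : Sym2 HexVertex) {x : ℝ} (hx : 0 ≤ x) (τ : ℝ) :
    ‖hexParafermionicObservable Λ a x τ z‖ ≤ ‖hexParafermionicObservable Λ a x 0 z‖ := by
  rw [norm_Z_eq_sum Λ a z hx]
  exact norm_hexParafermionicObservable_le Λ a hx τ z

/-- `(3/5)^N ≤ exp (-(κ log(5/3))/δ)` as soon as `N ≥ κ/δ`. [folklore] -/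
theorem pow_le_exp_of_le {x : ℝ} (hx0 : 0 < x) (hx1 : x ≤ 3 / 5) {κ δ : ℝ} {N : ℕ}
    (hN : κ / δ ≤ (N : ℝ)) :
    x ^ N ≤ Real.exp (-(κ * Real.log (5 / 3) / δ)) := by
  have hlog : 0 < Real.log (5 / 3) := Real.log_pos (by norm_num)
  have h35 : (0 : ℝ) < 3 / 5 := by norm_num
  calc x ^ N ≤ (3 / 5 : ℝ) ^ N := pow_le_pow_left₀ hx0.le hx1 N
    _ = Real.exp (Real.log ((3 / 5 : ℝ) ^ N)) := (Real.exp_log (pow_pos h35 N)).symm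
    _ = Real.exp (-(N * Real.log (5 / 3))) := by
        rw [Real.log_pow, show (3 / 5 : ℝ) = (5 / 3)⁻¹ by norm_num, Real.log_inv]; ring_nf
    _ ≤ Real.exp (-(κ * Real.log (5 / 3) / δ)) := by
        rw [Real.exp_le_exp, neg_le_neg_iff, show κ * Real.log (5 / 3) / δ = κ / δ * Real.log (5 / 3) by ring]
        exact mul_le_mul_of_nonneg_right hN hlog.le

/-- **Endgame at an arbitrary polynomial cut.** For `0 < x ≤ 3/5`, any real `c`, any `C` and any
`κ > 0`, an eventual inequality `δ² x^{ℓ_δ} ≤ C δ^{-c} x^{ℓ_δ + N_δ}` with `N_δ ≥ κ/δ` is impossible: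
`x^{N_δ} ≤ e^{-λ/δ}` beats every power of `δ`. [folklore] -/
theorem endgame_rpow {x : ℝ} (hx0 : 0 < x) (hx1 : x ≤ 3 / 5) (c C : ℝ) {κ : ℝ} (hκ : 0 < κ)
    (ℓ N : ℝ → ℕ)
    (hev : ∀ᶠ δ in nhdsWithin 0 (Set.Ioi 0),
      δ ^ 2 * x ^ (ℓ δ) ≤ C * δ ^ (-c) * x ^ (ℓ δ + N δ))
    (hN : ∀ᶠ δ in nhdsWithin 0 (Set.Ioi 0), κ / δ ≤ (N δ : ℝ)) : False := by
  set L : ℝ := κ * Real.log (5 / 3) with hL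
  have hLpos : 0 < L := mul_pos hκ (Real.log_pos (by norm_num))
  set ε : ℝ := 1 / (|C| + 1) with hε
  have hεpos : 0 < ε := by positivity
  -- `t^{2+c} e^{-L t} → 0` as `t → ∞`, pulled back along `δ ↦ δ⁻¹`
  have hlim := (tendsto_rpow_mul_exp_neg_mul_atTop_nhds_zero (2 + c) L hLpos).comp
    tendsto_inv_nhdsGT_zero
  have hsmallt : ∀ᶠ δ in nhdsWithin 0 (Set.Ioi 0),
      (δ⁻¹) ^ (2 + c) * Real.exp (-L * δ⁻¹) < ε := by
    have := hlim.eventually (Iio_mem_nhds hεpos)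
    filter_upwards [this] with δ hδ
    simpa using hδ
  have hpos : ∀ᶠ δ in nhdsWithin 0 (Set.Ioi 0), (0 : ℝ) < δ := self_mem_nhdsWithin
  obtain ⟨δ, hδ0, hineq, hNδ, hsm⟩ := (hpos.and (hev.and (hN.and hsmallt))).exists
  -- notation
  have hP : 0 < δ ^ 2 * δ ^ c := mul_pos (pow_pos hδ0 2) (Real.rpow_pos_of_pos hδ0 c)
  have hxl : 0 < x ^ (ℓ δ) := pow_pos hx0 _
  have hrc : 0 < δ ^ (-c) := Real.rpow_pos_of_pos hδ0 _
  -- sign of `C`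
  by_cases hC : C < 0
  · have : C * δ ^ (-c) * x ^ (ℓ δ + N δ) < 0 :=
      mul_neg_of_neg_of_pos (mul_neg_of_neg_of_pos hC hrc) (pow_pos hx0 _)
    have : (0 : ℝ) < δ ^ 2 * x ^ (ℓ δ) := by positivity
    linarith
  have hC' : 0 ≤ C := not_lt.1 hC
  -- cancel `x^ℓ`: `δ² ≤ C δ^{-c} x^N`
  have h1 : δ ^ 2 ≤ C * δ ^ (-c) * x ^ (N δ) := by
    have : δ ^ 2 * x ^ (ℓ δ) ≤ C * δ ^ (-c) * x ^ (N δ) * x ^ (ℓ δ) := by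
      calc δ ^ 2 * x ^ (ℓ δ) ≤ C * δ ^ (-c) * x ^ (ℓ δ + N δ) := hineq
        _ = C * δ ^ (-c) * x ^ (N δ) * x ^ (ℓ δ) := by rw [pow_add]; ring
    exact le_of_mul_le_mul_right this hxl
  -- `x^N ≤ e^{-L/δ}`
  have h2 : x ^ (N δ) ≤ Real.exp (-(L / δ)) := by
    have := pow_le_exp_of_le hx0 hx1 hNδ
    simpa [hL, mul_div_assoc] using this
  -- multiply by `δ^c`: `δ² δ^c ≤ C e^{-L/δ}`
  have h3 : δ ^ 2 * δ ^ c ≤ C * Real.exp (-(L / δ)) := by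
    have hcc : δ ^ (-c) * δ ^ c = 1 := by
      rw [Real.rpow_neg hδ0.le, inv_mul_cancel₀ (Real.rpow_pos_of_pos hδ0 c).ne']
    calc δ ^ 2 * δ ^ c ≤ C * δ ^ (-c) * x ^ (N δ) * δ ^ c :=
          mul_le_mul_of_nonneg_right h1 (Real.rpow_pos_of_pos hδ0 c).le
      _ = C * x ^ (N δ) * (δ ^ (-c) * δ ^ c) := by ring
      _ = C * x ^ (N δ) := by rw [hcc, mul_one]
      _ ≤ C * Real.exp (-(L / δ)) := mul_le_mul_of_nonneg_left h2 hC'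
  -- the smallness: `e^{-L/δ} < ε δ² δ^c`
  have h4 : Real.exp (-(L / δ)) < ε * (δ ^ 2 * δ ^ c) := by
    have hrew : (δ⁻¹) ^ (2 + c) = (δ ^ 2 * δ ^ c)⁻¹ := by
      rw [Real.inv_rpow hδ0.le, Real.rpow_add hδ0, Real.rpow_two]
    have hexp : Real.exp (-L * δ⁻¹) = Real.exp (-(L / δ)) := by
      congr 1; rw [div_eq_mul_inv]; ring
    rw [hrew, hexp] at hsm
    rw [inv_mul_lt_iff₀ hP] at hsm
    linarith [hsm]
  -- combine: `P ≤ C e < C ε P ≤ P`? — precisely `P ≤ C e ≤ C ε P < P`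
  have h5 : C * Real.exp (-(L / δ)) ≤ C * (ε * (δ ^ 2 * δ ^ c)) :=
    mul_le_mul_of_nonneg_left h4.le hC'
  have h6 : C * ε < 1 := by
    rw [hε, abs_of_nonneg hC']
    rw [mul_one_div, div_lt_one (by positivity)]
    linarith
  have h7 : C * (ε * (δ ^ 2 * δ ^ c)) < δ ^ 2 * δ ^ c := by
    have : C * (ε * (δ ^ 2 * δ ^ c)) = (C * ε) * (δ ^ 2 * δ ^ c) := by ring
    rw [this]
    exact mul_lt_of_lt_one_left hP h6
  linarith

/-- **Generic violation at cut `c`.** If eventually `δ² x_c^{k_δ} ≤ lhs_δ`, `0 ≤ rhs_δ ≤ x_c^{k_δ + N_δ}`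
and `N_δ ≥ κ/δ` (`κ > 0`), then `lhs_δ ≤ C δ^{-c} rhs_δ` cannot hold eventually, whatever `c, C`. [folklore] -/
theorem violates_of_core {c C κ : ℝ} (hκ : 0 < κ) (lhs rhs : ℝ → ℝ) (k N : ℝ → ℕ)
    (hcore : ∀ᶠ δ in nhdsWithin 0 (Set.Ioi 0),
      δ ^ 2 * hexCriticalFugacity ^ (k δ) ≤ lhs δ ∧ 0 ≤ rhs δ ∧
      rhs δ ≤ hexCriticalFugacity ^ (k δ + N δ) ∧ κ / δ ≤ (N δ : ℝ))
    (hev : ∀ᶠ δ in nhdsWithin 0 (Set.Ioi 0), lhs δ ≤ C * δ ^ (-c) * rhs δ) : False := by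
  have hx0 := hexCriticalFugacity_pos_lt_one.1
  have hpos : ∀ᶠ δ in nhdsWithin 0 (Set.Ioi 0), (0 : ℝ) < δ := self_mem_nhdsWithin
  by_cases hC : C < 0
  · obtain ⟨δ, hδ0, ⟨h1, h0, -, -⟩, h2⟩ := (hpos.and (hcore.and hev)).exists
    have hr : C * δ ^ (-c) * rhs δ ≤ 0 :=
      mul_nonpos_of_nonpos_of_nonneg
        (mul_nonpos_of_nonpos_of_nonneg hC.le (Real.rpow_pos_of_pos hδ0 _).le) h0
    have hl : 0 < δ ^ 2 * hexCriticalFugacity ^ (k δ) := by positivity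
    linarith
  have hC' : 0 ≤ C := not_lt.1 hC
  refine endgame_rpow hx0 xc_lt.le c C hκ k N ?_ ?_
  · filter_upwards [hcore, hev, hpos] with δ hδ h2 hδ0
    obtain ⟨h1, -, h3, -⟩ := hδ
    exact h1.trans (h2.trans (mul_le_mul_of_nonneg_left h3
      (mul_nonneg hC' (Real.rpow_pos_of_pos hδ0 _).le)))
  · filter_upwards [hcore] with δ hδ
    exact hδ.2.2.2

/-- `(2/3)/δ ≤ N` from the integer bookkeeping `4 (iK/2) ≤ N`, `1/(6δ) ≤ iK/2`. [folklore] -/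
theorem kappa_le {δ : ℝ} {N : ℕ} (hN : 4 * (iK δ / 2) ≤ N) (hn : 1 / (6 * δ) ≤ ((iK δ / 2 : ℕ) : ℝ))
    (hδ : 0 < δ) : 2 / 3 / δ ≤ (N : ℝ) := by
  have h1 : ((4 * (iK δ / 2) : ℕ) : ℝ) ≤ (N : ℝ) := by exact_mod_cast hN
  push_cast at h1
  have h2 : 2 / 3 / δ = 4 * (1 / (6 * δ)) := by field_simp; ring
  rw [h2]
  linarith

section AnyCut

variable {δ : ℝ}

/-- **Fjord family, any cut, any normalising spin.** `δ² Σ_{Kbox} Z ≤ C δ^{-c} |F_τ(b₂)|` fails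
eventually for every `c C τ : ℝ` (the corridor tip is starved by `x_c^{≈ 3/δ}`). [folklore] -/
theorem Λ₂_violates_at (c C τ : ℝ) :
    ¬ (∀ᶠ δ : ℝ in nhdsWithin 0 (Set.Ioi 0),
      δ ^ 2 * (∑ᶠ e ∈ {e : Sym2 HexVertex | e ∈ hexDomainMidEdges (Λ₂ δ) ∧
        (δ : ℂ) * hexMidpoint e ∈ Kbox},
        ‖hexParafermionicObservable (Λ₂ δ) (aE δ) hexCriticalFugacity 0 e‖) ≤
      C * δ ^ (-c) *
        ‖hexParafermionicObservable (Λ₂ δ) (aE δ) hexCriticalFugacity τ (b₂ δ)‖) := by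
  intro hev
  have hx0 := hexCriticalFugacity_pos_lt_one.1
  refine violates_of_core (κ := 2 / 3) (by norm_num) _ _ (fun δ => 2 * iK δ + 1)
    (fun δ => L₂ δ - 2 * iK δ) ?_ hev
  filter_upwards [Ioo_mem_nhdsGT (show (0:ℝ) < 1 / 100 by norm_num)] with δ hδ'
  have hδ0 := hδ'.1
  have hδ1 : δ ≤ 1 / 100 := hδ'.2.le
  obtain ⟨-, -, -, -, hpa, hpb, -, -, hN, -, hn⟩ := params hδ0 hδ1
  have hL := L₂_eq hδ0 hδ1
  have hE : ({e : Sym2 HexVertex | e ∈ hexDomainMidEdges (Λ₂ δ) ∧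
      (δ : ℂ) * hexMidpoint e ∈ Kbox}).Finite :=
    (hexDomainMidEdges_finite (Λ₂ δ)).subset fun e he => he.1
  have hterm := term_le_finsum_mem hE (f := fun e =>
    ‖hexParafermionicObservable (Λ₂ δ) (aE δ) hexCriticalFugacity 0 e‖) (fun e => norm_nonneg _)
    ⟨e₀_mem hδ0 hδ1, e₀_mem_Kbox hδ0 hδ1⟩
  have hwalk := pow_length_le_norm_Z (Λ₂ δ) (aE δ) (e₀ δ) (stairWalk hδ0 hδ1) hx0.le
  rw [stairWalk_length] at hwalk
  refine ⟨mul_le_mul_of_nonneg_left (hwalk.trans hterm) (by positivity), norm_nonneg _, ?_,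
    kappa_le (by omega) hn hδ0⟩
  have hexp : 2 * iK δ + 1 + (L₂ δ - 2 * iK δ) = L₂ δ + 1 := by omega
  rw [hexp, ← norm_Z_b₂ hδ0 hδ1]
  exact norm_F_le_norm_Z _ _ _ hx0.le τ

/-- **Slab family, any cut, any normalising spin.** [folklore] -/
theorem Λ₁_violates_at (c C τ : ℝ) :
    ¬ (∀ᶠ δ : ℝ in nhdsWithin 0 (Set.Ioi 0),
      δ ^ 2 * (∑ᶠ e ∈ {e : Sym2 HexVertex | e ∈ hexDomainMidEdges (Λ₁ δ) ∧
        (δ : ℂ) * hexMidpoint e ∈ Kbox},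
        ‖hexParafermionicObservable (Λ₁ δ) (aE δ) hexCriticalFugacity 0 e‖) ≤
      C * δ ^ (-c) *
        ‖hexParafermionicObservable (Λ₁ δ) (aE δ) hexCriticalFugacity τ (b₁ δ)‖) := by
  intro hev
  have hx0 := hexCriticalFugacity_pos_lt_one.1
  refine violates_of_core (κ := 2 / 3) (by norm_num) _ _ (fun δ => 2 * iK δ + 1)
    (fun δ => L₁ δ - 2 * iK δ) ?_ hev
  filter_upwards [Ioo_mem_nhdsGT (show (0:ℝ) < 1 / 100 by norm_num)] with δ hδ'
  have hδ0 := hδ'.1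
  have hδ1 : δ ≤ 1 / 100 := hδ'.2.le
  obtain ⟨-, -, -, -, hpa, hpb, -, -, -, hN, hn⟩ := params hδ0 hδ1
  have hL := L₁_eq hδ0 hδ1
  have hE : ({e : Sym2 HexVertex | e ∈ hexDomainMidEdges (Λ₁ δ) ∧
      (δ : ℂ) * hexMidpoint e ∈ Kbox}).Finite :=
    (hexDomainMidEdges_finite (Λ₁ δ)).subset fun e he => he.1
  have hterm := term_le_finsum_mem hE (f := fun e =>
    ‖hexParafermionicObservable (Λ₁ δ) (aE δ) hexCriticalFugacity 0 e‖) (fun e => norm_nonneg _)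
    ⟨e₀_mem_of (stair_mem₁ hδ0 hδ1 (by omega)), e₀_mem_Kbox hδ0 hδ1⟩
  have hwalk := pow_length_le_norm_Z (Λ₁ δ) (aE δ) (e₀ δ) (stairWalk₁ hδ0 hδ1) hx0.le
  rw [stairWalk₁, stairWalkIn_length] at hwalk
  refine ⟨mul_le_mul_of_nonneg_left (hwalk.trans hterm) (by positivity), norm_nonneg _, ?_,
    kappa_le (by omega) hn hδ0⟩
  have hexp : 2 * iK δ + 1 + (L₁ δ - 2 * iK δ) = L₁ δ + 1 := by omega
  rw [hexp, ← norm_Z_b₁ hδ0 hδ1]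
  exact norm_F_le_norm_Z _ _ _ hx0.le τ

/-- **Exhaustion-free family, any cut, any two spins.** [folklore] -/
theorem Λ₃_violates_at (c C σ τ : ℝ) :
    ¬ (∀ᶠ δ : ℝ in nhdsWithin 0 (Set.Ioi 0),
      δ ^ 2 * (∑ᶠ e ∈ {e : Sym2 HexVertex | e ∈ hexDomainMidEdges (Λ₃ δ) ∧
        (δ : ℂ) * hexMidpoint e ∈ Kbox},
        ‖hexParafermionicObservable (Λ₃ δ) (aE δ) hexCriticalFugacity σ e‖) ≤
      C * δ ^ (-c) * ‖hexParafermionicObservable (Λ₃ δ) (aE δ) hexCriticalFugacity τ (bE δ)‖) := by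
  intro hev
  have hx0 := hexCriticalFugacity_pos_lt_one.1
  refine violates_of_core (κ := 2 / 3) (by norm_num) _ _ (fun δ => 2 * iK δ + 1)
    (fun δ => L₃ δ - 2 * iK δ) ?_ hev
  filter_upwards [Ioo_mem_nhdsGT (show (0:ℝ) < 1 / 100 by norm_num)] with δ hδ'
  have hδ0 := hδ'.1
  have hδ1 : δ ≤ 1 / 100 := hδ'.2.le
  obtain ⟨-, -, -, -, hpa, hpb, -, -, -, -, hn⟩ := params hδ0 hδ1
  obtain ⟨-, -, -, -, -, hJ2, -⟩ := params₃ hδ0 hδ1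
  have hJ := J_eq hδ0 hδ1
  have hE : ({e : Sym2 HexVertex | e ∈ hexDomainMidEdges (Λ₃ δ) ∧
      (δ : ℂ) * hexMidpoint e ∈ Kbox}).Finite :=
    (hexDomainMidEdges_finite (Λ₃ δ)).subset fun e he => he.1
  have hstair : stair δ (2 * iK δ) ∈ Λ₃ δ := by
    rw [← c₃_eq_stair (by unfold I₀; omega)]; exact c₃_mem δ (by unfold L₃ I₀; omega)
  have hterm := term_le_finsum_mem hE (f := fun e =>
    ‖hexParafermionicObservable (Λ₃ δ) (aE δ) hexCriticalFugacity σ e‖) (fun e => norm_nonneg _)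
    ⟨e₀_mem_of hstair, e₀_mem_Kbox hδ0 hδ1⟩
  rw [norm_F_e₀_eq hδ0 hδ1 σ] at hterm
  refine ⟨mul_le_mul_of_nonneg_left hterm (by positivity), norm_nonneg _, ?_,
    kappa_le (by unfold L₃ I₀; omega) hn hδ0⟩
  have hexp : 2 * iK δ + 1 + (L₃ δ - 2 * iK δ) = L₃ δ + 1 := by unfold L₃ I₀; omega
  rw [hexp]; exact norm_F_bE_le hδ0 hδ1 τ

end AnyCut

/-! ## §L (cycle 4), continued: the crux and its hypothesis-dropped variants at an ARBITRARY cut `c`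

Named pieces of the crux's frame (`Flat`, `Frame`, `FrameNoRows`, `Exhausts`, `ALim`, `BLim`,
`Conclusion c σ τ`), the parametrised statement `MassRatioAt c σ τ` (`MassRatio` is LITERALLY
`MassRatioAt (3/4) 0 0`: `massRatio_iff_at`), and the four hypothesis-dropped variants at cut `c`,
bulk spin `σ`, normalising spin `τ`. Headlines: for EVERY real `c` and every `τ` (for exhaustion also
every `σ`) the variants are FALSE — `massRatioAt_false_without_rows`, `…_rho_pos`, `…_bLimit`,
`…_exhaustion`. In particular the dead line's stub 2 without exhaustion
(`= MassRatioAtWithoutExhaustion s (5/8) 0`) is false at every `s`, not only `s ≤ 1`. -/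

/-- flatness of `D` at `b = D.pt 1` in the `ρ`-ball [folklore] -/
def Flat (D : DobrushinDomain) (ρ : ℝ) : Prop :=
  D.carrier ∩ Metric.ball (D.pt 1) ρ = {z : ℂ | (D.pt 1).im < z.im} ∩ Metric.ball (D.pt 1) ρ

/-- the admissibility frame of the crux: simply connected, boundary mid-edges, a SAW, connected,
inside, rows clause in the `ρ`-ball (eventually) [folklore] -/
def Frame (D : DobrushinDomain) (ρ : ℝ) (Λ : ℝ → Finset HexVertex) (m : ℝ → ℤ)
    (a b : ℝ → Sym2 HexVertex) : Prop :=
  ∀ᶠ δ : ℝ in nhdsWithin 0 (Set.Ioi 0), hexDomainSimplyConnected (Λ δ) ∧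
    a δ ∈ hexDomainBoundary (Λ δ) ∧ b δ ∈ hexDomainBoundary (Λ δ) ∧
    Nonempty (HexMidEdgeSAW (Λ δ) (a δ) (b δ)) ∧
    (hexGraph.induce ((Λ δ : Finset HexVertex) : Set HexVertex)).Preconnected ∧
    (∀ v ∈ Λ δ, (δ : ℂ) * hexCenter v ∈ D.carrier) ∧
    (∀ v : HexVertex, (δ : ℂ) * hexCenter v ∈ Metric.ball (D.pt 1) ρ → (v ∈ Λ δ ↔ m δ ≤ v.1 1))

/-- the frame with the rows clause deleted [folklore] -/
def FrameNoRows (D : DobrushinDomain) (Λ : ℝ → Finset HexVertex) (a b : ℝ → Sym2 HexVertex) : Prop :=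
  ∀ᶠ δ : ℝ in nhdsWithin 0 (Set.Ioi 0), hexDomainSimplyConnected (Λ δ) ∧
    a δ ∈ hexDomainBoundary (Λ δ) ∧ b δ ∈ hexDomainBoundary (Λ δ) ∧
    Nonempty (HexMidEdgeSAW (Λ δ) (a δ) (b δ)) ∧
    (hexGraph.induce ((Λ δ : Finset HexVertex) : Set HexVertex)).Preconnected ∧
    (∀ v ∈ Λ δ, (δ : ℂ) * hexCenter v ∈ D.carrier)

/-- exhaustion of the compacts of `D` [folklore] -/
def Exhausts (D : DobrushinDomain) (Λ : ℝ → Finset HexVertex) : Prop :=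
  ∀ K : Set ℂ, IsCompact K → K ⊆ D.carrier → ∀ᶠ δ : ℝ in nhdsWithin 0 (Set.Ioi 0),
    ∀ v : HexVertex, (δ : ℂ) * hexCenter v ∈ K → v ∈ Λ δ

/-- `δ·mid(a_δ) → a` [folklore] -/
def ALim (D : DobrushinDomain) (a : ℝ → Sym2 HexVertex) : Prop :=
  Filter.Tendsto (fun δ : ℝ => (δ : ℂ) * hexMidpoint (a δ)) (nhdsWithin 0 (Set.Ioi 0)) (nhds (D.pt 0))

/-- `δ·mid(b_δ) → b` [folklore] -/
def BLim (D : DobrushinDomain) (b : ℝ → Sym2 HexVertex) : Prop :=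
  Filter.Tendsto (fun δ : ℝ => (δ : ℂ) * hexMidpoint (b δ)) (nhdsWithin 0 (Set.Ioi 0)) (nhds (D.pt 1))

/-- the conclusion at cut `c`, bulk spin `σ`, normalising spin `τ`:
`∀ K ⋐ D ∃ C, δ² Σ_{mid e ∈ K} |F_σ(e)| ≤ C δ^{-c} |F_τ(b_δ)|` eventually [folklore] -/
def Conclusion (c σ τ : ℝ) (D : DobrushinDomain) (Λ : ℝ → Finset HexVertex)
    (a b : ℝ → Sym2 HexVertex) : Prop :=
  ∀ K : Set ℂ, IsCompact K → K ⊆ D.carrier → ∃ C : ℝ, ∀ᶠ δ : ℝ in nhdsWithin 0 (Set.Ioi 0),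
    δ ^ 2 * (∑ᶠ e ∈ {e : Sym2 HexVertex | e ∈ hexDomainMidEdges (Λ δ) ∧
      (δ : ℂ) * hexMidpoint e ∈ K}, ‖hexParafermionicObservable (Λ δ) (a δ) hexCriticalFugacity σ e‖) ≤
      C * δ ^ (-c) * ‖hexParafermionicObservable (Λ δ) (a δ) hexCriticalFugacity τ (b δ)‖

/-- **The crux at cut `c`** (bulk spin `σ`, normalising spin `τ`; the crux is `c = 3/4`, `σ = τ = 0`). [folklore] -/
def MassRatioAt (c σ τ : ℝ) : Prop :=
  ∀ (D : DobrushinDomain) (ρ : ℝ) (Λ : ℝ → Finset HexVertex) (m : ℝ → ℤ) (a b : ℝ → Sym2 HexVertex),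
    0 < ρ → Flat D ρ → Frame D ρ Λ m a b → Exhausts D Λ → ALim D a → BLim D b → Conclusion c σ τ D Λ a b

/-- `MassRatio` is literally `MassRatioAt (3/4) 0 0`. [folklore] -/
theorem massRatio_iff_at : MassRatio ↔ MassRatioAt (3 / 4) 0 0 := by
  have h : ∀ δ : ℝ, δ ^ (-(3 : ℝ) / 4) = δ ^ (-(3 / 4 : ℝ)) := fun δ => by norm_num
  simp only [MassRatio, MassRatioAt, Flat, Frame, Exhausts, ALim, BLim, Conclusion, h]

/-- variant: rows clause (and its binder `m`) deleted [folklore] -/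
def MassRatioAtWithoutRows (c σ τ : ℝ) : Prop :=
  ∀ (D : DobrushinDomain) (ρ : ℝ) (Λ : ℝ → Finset HexVertex) (a b : ℝ → Sym2 HexVertex),
    0 < ρ → Flat D ρ → FrameNoRows D Λ a b → Exhausts D Λ → ALim D a → BLim D b →
      Conclusion c σ τ D Λ a b

/-- variant: `0 < ρ` deleted [folklore] -/
def MassRatioAtWithoutRhoPos (c σ τ : ℝ) : Prop :=
  ∀ (D : DobrushinDomain) (ρ : ℝ) (Λ : ℝ → Finset HexVertex) (m : ℝ → ℤ) (a b : ℝ → Sym2 HexVertex),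
    Flat D ρ → Frame D ρ Λ m a b → Exhausts D Λ → ALim D a → BLim D b → Conclusion c σ τ D Λ a b

/-- variant: `δ·mid(b_δ) → b` deleted [folklore] -/
def MassRatioAtWithoutBLimit (c σ τ : ℝ) : Prop :=
  ∀ (D : DobrushinDomain) (ρ : ℝ) (Λ : ℝ → Finset HexVertex) (m : ℝ → ℤ) (a b : ℝ → Sym2 HexVertex),
    0 < ρ → Flat D ρ → Frame D ρ Λ m a b → Exhausts D Λ → ALim D a → Conclusion c σ τ D Λ a b

/-- variant: exhaustion deleted [folklore] -/
def MassRatioAtWithoutExhaustion (c σ τ : ℝ) : Prop :=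
  ∀ (D : DobrushinDomain) (ρ : ℝ) (Λ : ℝ → Finset HexVertex) (m : ℝ → ℤ) (a b : ℝ → Sym2 HexVertex),
    0 < ρ → Flat D ρ → Frame D ρ Λ m a b → ALim D a → BLim D b → Conclusion c σ τ D Λ a b

/-- Each variant implies the cut-`c` crux with the corresponding hypothesis restored (they are
strengthenings); recorded as the contrapositive of interest: a refutation of `MassRatioAt c σ τ`
itself would follow from NONE of the four theorems below. [folklore] -/
theorem massRatioAt_of_without (c σ τ : ℝ) :
    (MassRatioAtWithoutRows c σ τ → MassRatioAt c σ τ) ∧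
    (MassRatioAtWithoutRhoPos c σ τ → MassRatioAt c σ τ) ∧
    (MassRatioAtWithoutBLimit c σ τ → MassRatioAt c σ τ) ∧
    (MassRatioAtWithoutExhaustion c σ τ → MassRatioAt c σ τ) := by
  refine ⟨fun h D ρ Λ m a b hρ hf hfr hex ha hb => h D ρ Λ a b hρ hf (hfr.mono fun δ hδ =>
      ⟨hδ.1, hδ.2.1, hδ.2.2.1, hδ.2.2.2.1, hδ.2.2.2.2.1, hδ.2.2.2.2.2.1⟩) hex ha hb,
    fun h D ρ Λ m a b _ hf hfr hex ha hb => h D ρ Λ m a b hf hfr hex ha hb,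
    fun h D ρ Λ m a b hρ hf hfr hex ha _ => h D ρ Λ m a b hρ hf hfr hex ha,
    fun h D ρ Λ m a b hρ hf hfr _ ha hb => h D ρ Λ m a b hρ hf hfr ha hb⟩

/-- **Rows clause load-bearing at every cut**: witness `D₀`, `ρ = 1`, fjord family `Λ₂`, `aE`, `b₂`,
`Kbox`. [folklore] -/
theorem massRatioAt_false_without_rows (c τ : ℝ) : ¬ MassRatioAtWithoutRows c 0 τ := by
  intro h
  obtain ⟨C, hC⟩ := h D₀ 1 Λ₂ aE b₂ one_pos D₀_flat frame_Λ₂ (fun K hK hKD => exhaust_Λ₂ hK hKD)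
    tendsto_aE tendsto_b₂ Kbox Kbox_compact Kbox_sub
  exact Λ₂_violates_at c C τ hC

/-- **`0 < ρ` load-bearing at every cut** (`ρ = 0` voids flatness and rows). [folklore] -/
theorem massRatioAt_false_without_rho_pos (c τ : ℝ) : ¬ MassRatioAtWithoutRhoPos c 0 τ := by
  intro h
  have hflat : Flat D₀ 0 := by simp [Flat]
  have hframe : Frame D₀ 0 Λ₂ mRow aE b₂ := by
    filter_upwards [frame_Λ₂] with δ hδ
    exact ⟨hδ.1, hδ.2.1, hδ.2.2.1, hδ.2.2.2.1, hδ.2.2.2.2.1, hδ.2.2.2.2.2, fun v hv => by simp at hv⟩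
  obtain ⟨C, hC⟩ := h D₀ 0 Λ₂ mRow aE b₂ hflat hframe (fun K hK hKD => exhaust_Λ₂ hK hKD)
    tendsto_aE tendsto_b₂ Kbox Kbox_compact Kbox_sub
  exact Λ₂_violates_at c C τ hC

/-- **`b_δ → b` load-bearing at every cut**: witness `D₀`, `ρ = 1`, slab family `Λ₁`, `aE`,
`b₁ → -i`, `Kbox`. [folklore] -/
theorem massRatioAt_false_without_bLimit (c τ : ℝ) : ¬ MassRatioAtWithoutBLimit c 0 τ := by
  intro h
  obtain ⟨C, hC⟩ := h D₀ 1 Λ₁ mRow aE b₁ one_pos D₀_flat frame_Λ₁ (fun K hK hKD => exhaust_Λ₁ hK hKD)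
    tendsto_aE Kbox Kbox_compact Kbox_sub
  exact Λ₁_violates_at c C τ hC

/-- **Exhaustion load-bearing at every cut and every pair of spins**: witness `D₀`, `ρ = 1/4`,
corridor-fed blob family `Λ₃`, `aE`, `bE`, `Kbox`. [folklore] -/
theorem massRatioAt_false_without_exhaustion (c σ τ : ℝ) : ¬ MassRatioAtWithoutExhaustion c σ τ := by
  intro h
  obtain ⟨C, hC⟩ := h D₀ (1 / 4) Λ₃ mRow aE bE (by norm_num) D₀_flat_quarter frame_Λ₃
    tendsto_aE tendsto_bE Kbox Kbox_compact Kbox_sub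
  exact Λ₃_violates_at c C σ τ hC

/-- The cycle-2/3 statements are the instances `c = 3/4`: e.g. `MassRatioWithoutExhaustion` is
`MassRatioAtWithoutExhaustion (3/4) 0 0`. [folklore] -/
theorem massRatioWithoutExhaustion_iff_at :
    MassRatioWithoutExhaustion ↔ MassRatioAtWithoutExhaustion (3 / 4) 0 0 := by
  have h : ∀ δ : ℝ, δ ^ (-(3 : ℝ) / 4) = δ ^ (-(3 / 4 : ℝ)) := fun δ => by norm_num
  simp only [MassRatioWithoutExhaustion, MassRatioAtWithoutExhaustion, Flat, Frame, ALim, BLim,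
    Conclusion, h]

end Summit.CriticalPhenomena.SAWScalingLimit.Cruxes.MassRatio.Disproof
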